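/-
Copyright (c) 2026. All rights reserved.
Released under Apache 2.0 license as described in the file LICENSE.
Authors: abc-iut cell, prover seat abc-iut-L4-t5 (gen 10; row «F3757-PORT», abc-iut-L4-lead m147 (5)), after abc-iut-f-101's
`LogFrobeniusMonoTelecoreObservablesOf.lean` (`sink_push_obs`, `sink_push_forget` — the mono-analytic twin), over files 1–5.
-/
import Literature.AnabelianGeometry.AbsoluteAnabelian.LogFrobeniusAnTelecoreObservablesPins
import HarnessLib

/-!
# [AbsTopIII] Cor 5.5 (iii), last sentence, inside `D_{An•}`: pushing the sinks forward (into the cores; along `𝒩⊞_v → 𝒩_v`)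

S. Mochizuki, *Topics in absolute anabelian geometry III: global reconstruction algorithms*,
J. Math. Sci. Univ. Tokyo 22 (2015) 939–1156 [MochizukiAbsTopIII2015]; manuscript `paper:url-5493eb38cbb7`, locators read on the
page: Cor 5.5 (iii) p. 131 (the observables `S_log⊞_v`, `S_log_v`; `λ_{v,ν}` = `λ⊞_{v,ν}` followed by `𝒩⊞_v → 𝒩_v`, Def 5.4 (iv)
p. 127), Def 3.5 (ii) p. 75 ("compatible"), (iv) p. 76, Rmk 3.5.1 p. 78.

WHAT (row «F3757-PORT», file 7 of the mover; the push-forward ingredients of abc-iut-f-101's `SinkSystem.push` for `D_{An•}`,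
after the mono-analytic `sink_push_obs` / `sink_push_forget`):
* `an_isOver_sinkη` — every sink homotopy lies over `Th•[Z]` (the lifts by construction; the observables' members by file 4's
  `isOver_anSinkη`, given `hoverPlus` / `hoverTS`);
* `an_push_lift` — INTO a core vertex (`An•[𝒳]`, `ℰ•`): the lift of the pushed pair is the member's homotopy whiskered (over-ness +
  uniqueness of over-homotopies into a fully faithful structure functor);
* `forgetHop_ofMem`, `an_push_forget` — ALONG `𝒩⊞_v → 𝒩_v`: a member at `𝒩⊞_v` (inner OR outer) followed by `[𝒩⊞_v → 𝒩_v]` is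
  a member at `𝒩_v` — the observable part is pushed by abc-iut-w5-d053's `pushFamily` and lands in `S_log_v` by the hypothesis
  `hpush` (abc-iut-w5-d144's `subFamily_pushFamily_logObsFamilyTS` at the carriers), the heads are unchanged;

Pure category theory; nothing here bears on [IUTchIII] Cor. 3.12; no side taken.
-/

set_option autoImplicit false

universe u

open CategoryTheory Quiver

namespace Literature.AnabelianGeometry.AbsoluteAnabelian

namespace LogFrobeniusSetting

open DiagramOfCategories

variable {Vmod : Type u} {isArc : Vmod → Bool} (L : LogFrobeniusSetting Vmod isArc)

/-! ## Push-forward INTO the core vertices -/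

section PushLift

variable (Hplus : ∀ v : Vmod, (L.logDiagramPlus v).HomotopyFamily) (Hts : ∀ v : Vmod, (L.logDiagramTS v).HomotopyFamily)
  (hoverPlus : ∀ (v : Vmod) (a : (logShapePlus (isArc := isArc) v).Vertex)
    (p q : Path a (logShapePlus (isArc := isArc) v).obs) (h : (Hplus v).E p q),
    L.anOverE.IsOver ((plusEmb (Vmod := Vmod) (isArc := isArc) v).mapPath p) ((plusEmb (Vmod := Vmod) (isArc := isArc) v).mapPath q)
      (L.embPlusHomAn v (Hplus v) h))
  (hoverTS : ∀ (v : Vmod) (a : (logShapeTS (isArc := isArc) v).Vertex)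
    (p q : Path a (logShapeTS (isArc := isArc) v).obs) (h : (Hts v).E p q),
    L.anOverE.IsOver ((tsEmb (Vmod := Vmod) (isArc := isArc) v).mapPath p) ((tsEmb (Vmod := Vmod) (isArc := isArc) v).mapPath q)
      (L.embTSHomAn v (Hts v) h))

include hoverPlus in
/-- The hypothesis `hoverPlus` in the form used by file 4. [cite: MochizukiAbsTopIII2015, Remark 3.5.1 p.78] -/
theorem hover_plusComapAn (v : Vmod) {a : (logShapePlus (isArc := isArc) v).Vertex} (p q : Path a (logShapePlus (isArc := isArc) v).obs)
    (h : (L.plusComapAn v (Hplus v)).E p q) :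
    L.anOverE.IsOver ((plusEmb (Vmod := Vmod) (isArc := isArc) v).mapPath p) ((plusEmb (Vmod := Vmod) (isArc := isArc) v).mapPath q)
      (LiftPair.ofMem (F := plusEmb v) (D := L.anDiagram) h).hom :=
  hoverPlus v a p q ((L.plusComapAn_E_iff v (Hplus v) p q).mp h)

include hoverTS in
/-- The hypothesis `hoverTS` in the form used by file 4. [cite: MochizukiAbsTopIII2015, Remark 3.5.1 p.78] -/
theorem hover_tsComapAn (v : Vmod) {a : (logShapeTS (isArc := isArc) v).Vertex} (p q : Path a (logShapeTS (isArc := isArc) v).obs)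
    (h : (L.tsComapAn v (Hts v)).E p q) :
    L.anOverE.IsOver ((tsEmb (Vmod := Vmod) (isArc := isArc) v).mapPath p) ((tsEmb (Vmod := Vmod) (isArc := isArc) v).mapPath q)
      (LiftPair.ofMem (F := tsEmb v) (D := L.anDiagram) h).hom :=
  hoverTS v a p q ((L.tsComapAn_E_iff v (Hts v) p q).mp h)

include hoverPlus hoverTS in
/-- **Every sink homotopy lies over `Th•[Z]`** (the lifts by construction; the observables' members by file 4's `isOver_anSinkη`).
[cite: MochizukiAbsTopIII2015, Remark 3.5.1 p.78] -/
theorem an_isOver_sinkη {a n : (anShape (Vmod := Vmod) (isArc := isArc)).Vertex} {p q : Path a n}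
    (h : (L.anSinkAt Hplus Hts n).E p q) : L.anOverE.IsOver p q ((L.anSinkAt Hplus Hts n).η h) := by
  rcases n with ⟨⟨k⟩ | _ | ⟨w⟩ | ⟨w⟩ | _ | _ | _ | ⟨w⟩ | ⟨w⟩ | _ | _ | _, hx⟩ | _
  · exact (h : False).elim
  · exact (h : False).elim
  · exact isOver_anSinkη (fun p q h => L.hover_plusComapAn Hplus hoverPlus w p q h) (plus_hnot w) h
  · exact isOver_anSinkη (fun p q h => L.hover_tsComapAn Hts hoverTS w p q h) (ts_hnot w) h
  · exact L.anOverE.isOver_lift _ p q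
  · exact (h : False).elim
  · exact (h : False).elim
  · exact (h : False).elim
  · exact (h : False).elim
  · exact (h : False).elim
  · exact (h : False).elim
  · exact (h : False).elim
  · exact L.anOverE.isOver_lift _ p q


include hoverPlus hoverTS in
/-- **Push-forward INTO a core vertex** (`An•[𝒳]` or `ℰ•`, fully faithful structure functor): the lift of a member pair followed
by any path `s` into it is the member's homotopy whiskered by `D_[s]` — that whiskering lies over `Th•[Z]` (Rmk 3.5.1) and the lift is
the unique such transformation (abc-iut-f-101's `IsOver.eq_lift`). [cite: MochizukiAbsTopIII2015, Remark 3.5.1 p.78] -/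
theorem an_push_lift {a n w : (anShape (Vmod := Vmod) (isArc := isArc)).Vertex} {p q : Path a n}
    (h : (L.anSinkAt Hplus Hts n).E p q) (s : Path n w) (hw : (L.anOverE.N w).FullyFaithful) (x : L.anDiagram.obj a) :
    (L.anOverE.lift hw (p.comp s) (q.comp s)).app x =
      eqToHom (L.anDiagram.pathFunctor_comp_obj p s x) ≫
        (L.anDiagram.pathFunctor s).map (((L.anSinkAt Hplus Hts n).η h).app x) ≫
          eqToHom (L.anDiagram.pathFunctor_comp_obj q s x).symm := by
  have ho := ((L.an_isOver_sinkη Hplus Hts hoverPlus hoverTS h).whiskerRight s).eq_lift hw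
  rw [← ho]
  simp only [NatTrans.comp_app, eqToHom_app, Functor.whiskerRight_app]
  rfl

end PushLift

/-! ## Push-forward ALONG `𝒩⊞_v → 𝒩_v` -/

section PushForget

variable (Hplus : ∀ v : Vmod, (L.logDiagramPlus v).HomotopyFamily) (Hts : ∀ v : Vmod, (L.logDiagramTS v).HomotopyFamily)
  (hpush : ∀ v : Vmod, SubFamily (pushFamily (Hplus v)) (Hts v)) (v : Vmod)

include hpush in
/-- **The observable part of a member at `𝒩⊞_v`, pushed**: for a boundary pair `(u, u')` of `S_log⊞_v` out of a base vertex, the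
pushed pair `(u ; [𝒩⊞_v → 𝒩_v], u' ; [𝒩⊞_v → 𝒩_v])` is a boundary pair of `S_log_v` (abc-iut-w5-d053's `pushFamily`, `hpush`) whose
homotopy, read in `D_{An•}`, is `ζ_{(u,u')} ▹ D_[𝒩⊞_v → 𝒩_v]`. [cite: MochizukiAbsTopIII2015, Cor 5.5 (iii) p. 131] -/
theorem forgetHop_ofMem (c : DSub (DVertex.InFirstRows (isArc := isArc) 2))
    {u u' : Path ((logShapePlus (isArc := isArc) v).base c) (logShapePlus (isArc := isArc) v).obs}
    (m : (L.plusComapAn v (Hplus v)).E u u') :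
    ∃ memT : (L.tsComapAn v (Hts v)).E (((plusToTS v).mapPath u).cons (forgetEdgeTS v)) (((plusToTS v).mapPath u').cons (forgetEdgeTS v)),
      (LiftPair.ofMem (F := tsEmb v) (D := L.anDiagram) memT).hom =
        eqToHom (L.anDiagram.pathFunctor_eq_of_eq_comp _ _ (tsEmb_mapPath_push v c u)) ≫
          Functor.whiskerRight (LiftPair.ofMem (F := plusEmb v) (D := L.anDiagram) m).hom
            (L.anDiagram.pathFunctor (edgePath (forgetArrowAn (Vmod := Vmod) (isArc := isArc) v))) ≫
          eqToHom (L.anDiagram.pathFunctor_eq_of_eq_comp _ _ (tsEmb_mapPath_push v c u')).symm := by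
  have m₀ : (Hplus v).E u u' := (L.plusComapAn_E_iff v (Hplus v) u u').mp m
  have hpE : (pushFamily (Hplus v)).E (((plusToTS v).mapPath u).cons (forgetEdgeTS v))
      (((plusToTS v).mapPath u').cons (forgetEdgeTS v)) := ⟨PushPair.ofMem c m₀⟩
  obtain ⟨hts, hηts⟩ := hpush v _ _ hpE
  refine ⟨(L.tsComapAn_E_iff v (Hts v) _ _).mpr hts, ?_⟩
  ext X
  -- both sides are `(𝒩⊞_v → 𝒩_v)` applied to the component of `ζ_{(u,u')}`, up to canonical identifications
  have h1 : HEq ((LiftPair.ofMem (F := tsEmb v) (D := L.anDiagram) ((L.tsComapAn_E_iff v (Hts v) _ _).mpr hts)).hom.app X)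
      (((Hts v).η hts).app X) := L.embTSHomAn_app_heq v (Hts v) ⟨c.1, Or.inl c.2⟩ hts X
  have h2 : ((Hts v).η hts).app X = ((pushFamily (Hplus v)).η hpE).app X := by rw [hηts]
  have h3 : HEq (((pushFamily (Hplus v)).η hpE).app X) ((L.forget v).map (((Hplus v).η m₀).app X)) :=
    pushFamily_η_app_heq (Hplus v) c m₀ hpE X
  have hD := L.logDiagramPlus_eq_comapAlongAn v
  have hF : ∀ r : Path ((logShapePlus (isArc := isArc) v).base c) (logShapePlus (isArc := isArc) v).obs,
      (L.logDiagramPlus v).pathFunctor r = L.anDiagram.pathFunctor ((plusEmb (Vmod := Vmod) (isArc := isArc) v).mapPath r) :=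
    fun r => eq_of_heq ((DiagramOfCategories.pathFunctor_heq_of_eq hD r).trans
      (heq_of_eq (L.anDiagram.pathFunctor_comapAlong (plusEmb v) r)))
  have h4 : HEq ((L.forget v).map (((Hplus v).η m₀).app X))
      ((L.forget v).map ((LiftPair.ofMem (F := plusEmb v) (D := L.anDiagram) m).hom.app X)) :=
    map_heq_of_heq (L.forget v) (Functor.congr_obj (hF u) X) (Functor.congr_obj (hF u') X)
      (L.embPlusHomAn_app_heq v (Hplus v) c m₀ X).symm
  have h5 : HEq ((L.forget v).map ((LiftPair.ofMem (F := plusEmb v) (D := L.anDiagram) m).hom.app X))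
      ((L.anDiagram.pathFunctor (edgePath (forgetArrowAn (Vmod := Vmod) (isArc := isArc) v))).map
        ((LiftPair.ofMem (F := plusEmb v) (D := L.anDiagram) m).hom.app X)) :=
    map_heq_of_functor_eq' (L.pathFunctor_forgetArrowAn v).symm _
  refine eq_of_heq_of_heq (h1.trans ((heq_of_eq h2).trans (h3.trans (h4.trans h5)))) ?_
  exact (heq_of_eq (app_conj_whiskerRight _ _ (L.anDiagram.pathFunctor_eq_of_eq_comp _ _ (tsEmb_mapPath_push v c u))
      (L.anDiagram.pathFunctor_eq_of_eq_comp _ _ (tsEmb_mapPath_push v c u')) X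
      (L.anDiagram.pathFunctor_obj_of_eq_comp _ _ (tsEmb_mapPath_push v c u) X)
      (L.anDiagram.pathFunctor_obj_of_eq_comp _ _ (tsEmb_mapPath_push v c u') X).symm)).trans
    (DiagramOfCategories.HomotopyFamily.heq_eqToHom_comp_comp_eqToHom _ _ _)

/-- **An outer member at `𝒩⊞_v` pushed along `𝒩⊞_v → 𝒩_v`**: same heads `(a, b)`, same telecore edge, observable part the pushed
pair (a boundary pair of `S_log_v` by `forgetHop_ofMem`). [cite: MochizukiAbsTopIII2015, Cor 5.5 (iii) p. 131] -/
def OuterDec.pushForget {x : (anShape (Vmod := Vmod) (isArc := isArc)).Vertex}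
    {Pth Qth : Path x ((plusEmb (Vmod := Vmod) (isArc := isArc) v).obj (logShapePlus (isArc := isArc) v).obs)} :
    (d : OuterDec L (DVertex.InFirstRows 2) (.nplus v) inFive_of_inTwo' (nplus_mem_five v) (L.plusComapAn v (Hplus v)) Pth Qth) →
    (L.tsComapAn v (Hts v)).E (((plusToTS v).mapPath d.u).cons (forgetEdgeTS v)) (((plusToTS v).mapPath d.u').cons (forgetEdgeTS v)) →
    OuterDec L (InPortionThree v) (.nv v) (inFive_of_inPortionThree' v) (nv_mem_five v) (L.tsComapAn v (Hts v))
      (Pth.comp (edgePath (forgetArrowAn (Vmod := Vmod) (isArc := isArc) v)))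
      (Qth.comp (edgePath (forgetArrowAn (Vmod := Vmod) (isArc := isArc) v)))
  | ⟨a, b, c, hc, j, u, u', _, hl, hr⟩, memT =>
    ⟨a, b, c, Or.inl hc, j, ((plusToTS v).mapPath u).cons (forgetEdgeTS v), ((plusToTS v).mapPath u').cons (forgetEdgeTS v), memT,
      hl.symm ▸ (Path.comp_assoc _ _ _).trans (congrArg _ (tsEmb_mapPath_push v ⟨c, hc⟩ u).symm),
      hr.symm ▸ (Path.comp_assoc _ _ _).trans (congrArg _ (tsEmb_mapPath_push v ⟨c, hc⟩ u').symm)⟩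

/-- Its homotopy is the original outer homotopy whiskered by `D_[𝒩⊞_v → 𝒩_v]` (file 3a's `outerShape` bookkeeping).
[cite: MochizukiAbsTopIII2015, Cor 5.5 (iii) p. 131] -/
theorem OuterDec.hom_pushForget {x : (anShape (Vmod := Vmod) (isArc := isArc)).Vertex}
    (a b : Path x (anShape (Vmod := Vmod) (isArc := isArc)).obs) (c : DVertex Vmod isArc) (hc : DVertex.InFirstRows 2 c)
    (j : (anShape (Vmod := Vmod) (isArc := isArc)).obs ⟶ (anShape (Vmod := Vmod) (isArc := isArc)).base ⟨c, inFive_of_inTwo' hc⟩)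
    (u u' : Path ((logShapePlus (isArc := isArc) v).base ⟨c, hc⟩) (logShapePlus (isArc := isArc) v).obs)
    (m : (L.plusComapAn v (Hplus v)).E u u')
    {Pth Qth : Path x ((plusEmb (Vmod := Vmod) (isArc := isArc) v).obj (logShapePlus (isArc := isArc) v).obs)}
    (hl : Pth = (a.comp (edgePath j)).comp ((plusEmb (Vmod := Vmod) (isArc := isArc) v).mapPath u))
    (hr : Qth = (b.comp (edgePath j)).comp ((plusEmb (Vmod := Vmod) (isArc := isArc) v).mapPath u'))
    (memT : (L.tsComapAn v (Hts v)).E (((plusToTS v).mapPath u).cons (forgetEdgeTS v))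
      (((plusToTS v).mapPath u').cons (forgetEdgeTS v)))
    (eT : (LiftPair.ofMem (F := tsEmb v) (D := L.anDiagram) memT).hom =
        eqToHom (L.anDiagram.pathFunctor_eq_of_eq_comp _ _ (tsEmb_mapPath_push v ⟨c, hc⟩ u)) ≫
          Functor.whiskerRight (LiftPair.ofMem (F := plusEmb v) (D := L.anDiagram) m).hom
            (L.anDiagram.pathFunctor (edgePath (forgetArrowAn (Vmod := Vmod) (isArc := isArc) v))) ≫
          eqToHom (L.anDiagram.pathFunctor_eq_of_eq_comp _ _ (tsEmb_mapPath_push v ⟨c, hc⟩ u')).symm) :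
    (OuterDec.pushForget L Hplus Hts v ⟨a, b, c, hc, j, u, u', m, hl, hr⟩ memT).hom =
      eqToHom (L.anDiagram.pathFunctor_comp Pth _) ≫
        Functor.whiskerRight (OuterDec.hom ⟨a, b, c, hc, j, u, u', m, hl, hr⟩)
          (L.anDiagram.pathFunctor (edgePath (forgetArrowAn (Vmod := Vmod) (isArc := isArc) v))) ≫
        eqToHom (L.anDiagram.pathFunctor_comp Qth _).symm := by
  subst hl hr
  rw [OuterDec.hom, OuterDec.hom, OuterDec.tailHom, OuterDec.tailHom]
  dsimp only [OuterDec.pushForget]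
  exact outerShape_whiskerRight (L.headHom a b j) (LiftPair.ofMem (F := plusEmb v) (D := L.anDiagram) m).hom
    (L.anDiagram.pathFunctor (edgePath (forgetArrowAn v)))
    (L.anDiagram.pathFunctor_eq_of_eq_comp _ _ (tsEmb_mapPath_push v ⟨c, hc⟩ u))
    (L.anDiagram.pathFunctor_eq_of_eq_comp _ _ (tsEmb_mapPath_push v ⟨c, hc⟩ u')) eT
    (L.anDiagram.pathFunctor_eq_of_eq_comp _ _ rfl) (L.anDiagram.pathFunctor_eq_of_eq_comp _ _ rfl)
    (L.anDiagram.pathFunctor_eq_of_eq_comp _ _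
      (OuterDec.pushForget L Hplus Hts v ⟨a, b, c, hc, j, u, u', m, rfl, rfl⟩ memT).left_eq)
    (L.anDiagram.pathFunctor_eq_of_eq_comp _ _
      (OuterDec.pushForget L Hplus Hts v ⟨a, b, c, hc, j, u, u', m, rfl, rfl⟩ memT).right_eq)
    (L.anDiagram.pathFunctor_comp _ _) (L.anDiagram.pathFunctor_comp _ _)

include hpush in
/-- **Push-forward ALONG `𝒩⊞_v → 𝒩_v`**: a member of the sink at `𝒩⊞_v` — inner (an embedded pair of `S_log⊞_v`) or outer (lift at
`An•[𝒳]`, telecore edge, pair of `S_log⊞_v`) — followed by `[𝒩⊞_v → 𝒩_v]` is a member of the sink at `𝒩_v` of the same kind (the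
observable part pushed, `forgetHop_ofMem`; the heads unchanged), with the whiskered homotopy.
[cite: MochizukiAbsTopIII2015, Cor 5.5 (iii) p. 131] -/
theorem an_push_forget {a : (anShape (Vmod := Vmod) (isArc := isArc)).Vertex}
    {p q : Path a ((anShape (Vmod := Vmod) (isArc := isArc)).base ⟨.nplus v, nplus_mem_five v⟩)}
    (h : (L.anSinkAt Hplus Hts _).E p q) :
    ∃ h' : (L.anSinkAt Hplus Hts ((anShape (Vmod := Vmod) (isArc := isArc)).base ⟨.nv v, nv_mem_five v⟩)).E
        (p.comp (edgePath (forgetArrowAn (Vmod := Vmod) (isArc := isArc) v)))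
        (q.comp (edgePath (forgetArrowAn (Vmod := Vmod) (isArc := isArc) v))),
      (L.anSinkAt Hplus Hts _).η h' =
        eqToHom (L.anDiagram.pathFunctor_comp p _) ≫
          Functor.whiskerRight ((L.anSinkAt Hplus Hts _).η h)
            (L.anDiagram.pathFunctor (edgePath (forgetArrowAn (Vmod := Vmod) (isArc := isArc) v))) ≫
          eqToHom (L.anDiagram.pathFunctor_comp q _).symm := by
  have hnotP := plus_hnot (Vmod := Vmod) (isArc := isArc) v
  have hnotT := ts_hnot (Vmod := Vmod) (isArc := isArc) v
  obtain ⟨d⟩ := id h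
  have eη : (L.anSinkAt Hplus Hts ((anShape (Vmod := Vmod) (isArc := isArc)).base ⟨.nplus v, nplus_mem_five v⟩)).η h = d.hom :=
    sinkη_eq hnotP h d
  rw [eη]
  rcases d with ⟨w₀, hw₀⟩ | d
  · -- inner member
    obtain ⟨src, left, right, mem, hs, hl, hr⟩ := w₀
    rcases src with c | _
    swap
    · exact (hw₀ rfl).elim
    subst hs; cases hl; cases hr
    obtain ⟨memT, eT⟩ := L.forgetHop_ofMem Hplus Hts hpush v c mem
    have hpl := tsEmb_mapPath_push (Vmod := Vmod) (isArc := isArc) v c left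
    have hpr := tsEmb_mapPath_push (Vmod := Vmod) (isArc := isArc) v c right
    let w' : LiftPair (tsEmb v) L.anDiagram (logShapeTS v).obs (L.tsComapAn v (Hts v))
        (((plusEmb (Vmod := Vmod) (isArc := isArc) v).mapPath left).comp (edgePath (forgetArrowAn v)))
        (((plusEmb (Vmod := Vmod) (isArc := isArc) v).mapPath right).comp (edgePath (forgetArrowAn v))) :=
      ⟨(logShapeTS v).base ⟨c.1, Or.inl c.2⟩, _, _, memT, rfl, heq_of_eq hpl, heq_of_eq hpr⟩
    have hw' : w'.src ≠ (logShapeTS (isArc := isArc) v).obs := fun h => by cases h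
    have hmem : (L.anSinkAt Hplus Hts ((anShape (Vmod := Vmod) (isArc := isArc)).base ⟨.nv v, nv_mem_five v⟩)).E
        (((plusEmb (Vmod := Vmod) (isArc := isArc) v).mapPath left).comp (edgePath (forgetArrowAn v)))
        (((plusEmb (Vmod := Vmod) (isArc := isArc) v).mapPath right).comp (edgePath (forgetArrowAn v))) := ⟨Sum.inl ⟨w', hw'⟩⟩
    refine ⟨hmem, ?_⟩
    have e1 : (L.anSinkAt Hplus Hts ((anShape (Vmod := Vmod) (isArc := isArc)).base ⟨.nv v, nv_mem_five v⟩)).η hmem = w'.hom :=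
      sinkη_eq hnotT hmem (Sum.inl ⟨w', hw'⟩)
    have e2 : w'.hom = eqToHom _ ≫ (eqToHom (L.anDiagram.pathFunctor_comapAlong (tsEmb v) _).symm ≫
        (L.tsComapAn v (Hts v)).η memT ≫ eqToHom (L.anDiagram.pathFunctor_comapAlong (tsEmb v) _)) ≫ eqToHom _ :=
      L.anDiagram.transportHom_eq hpl hpr _
    refine e1.trans (e2.trans ?_)
    rw [← LiftPair.hom_ofMem (F := tsEmb v) (D := L.anDiagram) memT, eT]
    change _ = eqToHom _ ≫ Functor.whiskerRight (LiftPair.ofMem (F := plusEmb v) (D := L.anDiagram) mem).hom _ ≫ eqToHom _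
    exact eqToHom_conj_conj _ _ _ _ _ _ _
  · -- outer member: heads unchanged, observable part pushed
    obtain ⟨ha, hb, c, hc, j, u, u', m, hl, hr⟩ := d
    obtain ⟨memT, eT⟩ := L.forgetHop_ofMem Hplus Hts hpush v ⟨c, hc⟩ m
    have hmem : (L.anSinkAt Hplus Hts ((anShape (Vmod := Vmod) (isArc := isArc)).base ⟨.nv v, nv_mem_five v⟩)).E
        (p.comp (edgePath (forgetArrowAn v))) (q.comp (edgePath (forgetArrowAn v))) :=
      ⟨Sum.inr (OuterDec.pushForget L Hplus Hts v ⟨ha, hb, c, hc, j, u, u', m, hl, hr⟩ memT)⟩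
    refine ⟨hmem, ?_⟩
    have e1 : (L.anSinkAt Hplus Hts ((anShape (Vmod := Vmod) (isArc := isArc)).base ⟨.nv v, nv_mem_five v⟩)).η hmem =
        (OuterDec.pushForget L Hplus Hts v ⟨ha, hb, c, hc, j, u, u', m, hl, hr⟩ memT).hom :=
      sinkη_eq hnotT hmem (Sum.inr _)
    exact e1.trans (OuterDec.hom_pushForget L Hplus Hts v ha hb c hc j u u' m hl hr memT eT)

include hpush in
/-- The same, componentwise (the form used by abc-iut-f-101's `SinkSystem.push`). [cite: MochizukiAbsTopIII2015, Cor 5.5 (iii) p. 131] -/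
theorem an_push_forget_app {a : (anShape (Vmod := Vmod) (isArc := isArc)).Vertex}
    {p q : Path a ((anShape (Vmod := Vmod) (isArc := isArc)).base ⟨.nplus v, nplus_mem_five v⟩)}
    (h : (L.anSinkAt Hplus Hts _).E p q) :
    ∃ h' : (L.anSinkAt Hplus Hts ((anShape (Vmod := Vmod) (isArc := isArc)).base ⟨.nv v, nv_mem_five v⟩)).E
        (p.comp (edgePath (forgetArrowAn (Vmod := Vmod) (isArc := isArc) v)))
        (q.comp (edgePath (forgetArrowAn (Vmod := Vmod) (isArc := isArc) v))),
      ∀ X : L.anDiagram.obj a, ((L.anSinkAt Hplus Hts _).η h').app X =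
        eqToHom (L.anDiagram.pathFunctor_comp_obj p _ X) ≫
          (L.anDiagram.pathFunctor (edgePath (forgetArrowAn (Vmod := Vmod) (isArc := isArc) v))).map
              (((L.anSinkAt Hplus Hts _).η h).app X) ≫
            eqToHom (L.anDiagram.pathFunctor_comp_obj q _ X).symm := by
  obtain ⟨h', e⟩ := L.an_push_forget Hplus Hts hpush v h
  exact ⟨h', fun X => (NatTrans.congr_app e X).trans
    (app_conj_whiskerRight _ _ (L.anDiagram.pathFunctor_comp p _) (L.anDiagram.pathFunctor_comp q _) X _ _)⟩

end PushForget

end LogFrobeniusSetting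

end Literature.AnabelianGeometry.AbsoluteAnabelian
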